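import Literature.Analysis.FluidPDE.TypeIRateOseenMildRepresentative
import Literature.Analysis.FluidPDE.GigaMiura2011ScaledAlignmentBlowupLimitHolds
import Literature.Analysis.FluidPDE.NSBoundedMildOseenClassical
import Literature.Analysis.FluidPDE.PressureReconstruction
import Literature.Analysis.FluidPDE.KNSSMildRegularity
import Literature.Analysis.FluidPDE.SuitableWeakBoundedWindow
import Literature.Analysis.FluidPDE.LeiRenZhang2019SlidingVelocity
import Literature.Analysis.FluidPDE.KNSSRegularityGluing
import Literature.Analysis.FluidPDE.TypeIAncientMild
import Literature.Analysis.FluidPDE.NSLerayStrongLocalExistence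
import Literature.Analysis.FluidPDE.SuitableWeakExhaustion
import Literature.Analysis.FluidPDE.SuitableWeakCongr
import Literature.Analysis.FluidPDE.LocalTypeICongr
import HarnessLib

/-!
# Type-I-rate suitable weak solutions with `𝐈 < ∞` are CLASSICAL on the open backward slab

Analysis/FluidPDE proof file (theorems only; no definitions, no named facts).

`TypeIRateOseenMildRepresentative.exists_oseenMild_repr_of_typeIBound_lt_top` shows that a suitable
weak solution `(u, p)` of the unforced Navier–Stokes system (`ν = 1`) on `(−∞, 0) × EuclideanSpace ℝ (Fin 3)` with the
Type-I rate `‖u(t,x)‖ ≤ C/√(−t)` and Albritton–Barker's `𝐈(EuclideanSpace ℝ (Fin 3) × ℝ₋) < ∞` is a.e. equal to a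
continuous, bounded-on-every-`(−∞,−δ)`, Oseen-mild ("mild bounded ancient", KNSS 2009 §4 (i)) field
`v`. This file finishes the regularity bookkeeping that the printed sources state in one breath
(KNSS 2009, §4 (iii) and Prop. 4.1: "mild bounded solutions … are smooth", with the associated
pressure of §4 (4.3)–(4.5); Albritton–Barker 2019, Thm. 1.1 / §3: the Type-I blow-up object "is a
mild bounded ancient solution", hence smooth):

* `isSmoothSpaceTimeOn_of_oseenAncient_rate` — a continuous Oseen-mild field on `(−∞,0) × EuclideanSpace ℝ (Fin 3)` with
  weakly divergence-free slices and the Type-I rate is jointly `C^∞` on the open slab (KNSS Prop. 4.1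
  through the tree's `contDiffOn_of_bounded_oseenMild`, applied to the bounded time-shifts
  `τ ↦ v(τ − δ)`);
* `exists_isClassicalNSSolutionOn_of_smooth_boundedWeak` — a jointly smooth bounded weak solution on
  a window `(a, c) × EuclideanSpace ℝ (Fin 3)` is a classical solution there for some (smooth) pressure (de Rham /
  pressure reconstruction: the tree's `integral_inner_momentum_eq_zero_of_slab_weak` and
  `exists_isClassicalNSSolutionOn_of_forall_integral_inner_eq_zero`);
* `exists_classical_repr_of_typeIBound_lt_top` — MAIN: under the hypotheses of
  `exists_oseenMild_repr_of_typeIBound_lt_top`, the representative `v` is jointly smooth on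
  `(−∞,0) × EuclideanSpace ℝ (Fin 3)` and, on every window `(a, c)`, `c < 0`, a classical solution `(v, q)` for some
  pressure `q`; `exists_classical_repr_Icc_of_typeIBound_lt_top` is the closed-strip form
  `[b − T, b]`, `b < 0` (the frame of the tree's `TaoMainEstimate*` theorems, e.g.
  `IsClassicalNSSolutionOn.vorticity_annulus_lower_bound`);
* `isSuitableWeakSolutionOn_slab_of_forall_inBall`, `exists_classical_repr_of_apexPackage` — the
  APEX-PACKAGE form: `(U, P)` suitable weak in every cylinder `Q((0,0), a)`, the rate only for
  a.e. `y` at each `s < 0`, and `𝐈(Q((0,0), a)) ≤ M` for all `a` (exhaustion of the slab, a null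
  modification making the rate pointwise, `𝐈((−∞,0) × ℝ³) ≤ M`).

Consumers: the extinct-apex lines of stmt-NavierStokesRegularity-18385 (nsreg-p2 ROUND-26, road C
`classicalUpgrade_at_depth`): below the top time an extinct Type-I apex IS a global classical
solution, so Tao's §5 Carleman chain applies by name at `b = −ε`.

## References

* G. Koch, N. Nadirashvili, G. Seregin, V. Šverák, *Liouville theorems for the Navier–Stokes
  equations and applications*, Acta Math. 203 (2009) = arXiv:0709.3599, §4 (i)–(iii), (4.3)–(4.6),
  Prop. 4.1. [KochNadirashviliSereginSverak2009]
* D. Albritton, T. Barker, *On local Type I singularities of the Navier–Stokes equations and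
  Liouville theorems*, J. Math. Fluid Mech. 21 (2019) = arXiv:1811.00502, Thm. 1.1, §3.
  [AlbrittonBarker2019]
-/

noncomputable section

open MeasureTheory Set Function Filter Metric TopologicalSpace
open _root_.Topology
open scoped NNReal ENNReal RealInnerProductSpace

namespace Literature.Analysis.FluidPDE

/-! ### Smoothness of Oseen-ancient fields with the Type-I rate -/

section Smooth

variable {v : ℝ → EuclideanSpace ℝ (Fin 3) → EuclideanSpace ℝ (Fin 3)} {C : ℝ}

/-- **A continuous Oseen-mild ancient field with the Type-I rate is jointly smooth on the open
backward slab** (KNSS 2009, §4 (iii) / Prop. 4.1: bounded mild solutions are smooth — applied to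
the bounded time-shifts `τ ↦ v(τ − δ)` on `(A, 0)`, `δ > 0`, via the tree's
`contDiffOn_of_bounded_oseenMild`). [cite: KochNadirashviliSereginSverak2009, Prop. 4.1 and §4 (iii) (arXiv:0709.3599v1 p. 8)] -/
theorem isSmoothSpaceTimeOn_of_oseenAncient_rate
    (hc : ContinuousOn (uncurry v) (Iio (0 : ℝ) ×ˢ univ))
    (hdiv : ∀ t < 0, IsWeaklyDivFree (v t))
    (hmild : ∀ s t : ℝ, s < t → t < 0 → ∀ x,
      v t x = UnboundedOperators.heatExtension (v s) (t - s) x - oseenDuhamel 1 s v v t x)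
    (hC : HasTypeITimeDecay C v) :
    IsSmoothSpaceTimeOn (Iio 0) v := by
  -- `C ≥ 0`
  have hC0 : 0 ≤ C := by
    have h := hC (-1) (by norm_num) 0
    rw [neg_neg, Real.sqrt_one, div_one] at h
    exact (norm_nonneg _).trans h
  refine contDiffOn_of_locally_contDiffOn ?_
  rintro ⟨t, x⟩ ⟨ht, -⟩
  have ht0 : t < 0 := ht
  -- the shift `δ = −t/2 > 0` and the shifted field `w τ = v (τ − δ)` on `(A, 0)`, `A = t`
  set δ : ℝ := -t / 2 with hδ
  have hδ0 : 0 < δ := by rw [hδ]; linarith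
  set w : ℝ → EuclideanSpace ℝ (Fin 3) → EuclideanSpace ℝ (Fin 3) := fun τ => v (τ - δ) with hw
  have hwc : ContinuousOn (uncurry w) (Ioo t 0 ×ˢ univ) := by
    have e : uncurry w = uncurry v ∘ fun z : ℝ × EuclideanSpace ℝ (Fin 3) => (z.1 - δ, z.2) := by
      funext z; rfl
    rw [e]
    refine hc.comp ((continuous_fst.sub continuous_const).prodMk continuous_snd).continuousOn ?_
    rintro ⟨τ, y⟩ ⟨hτ, -⟩
    exact ⟨show τ - δ < 0 by have := hτ.2; linarith, mem_univ _⟩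
  have hwdiv : ∀ τ ∈ Ioo t 0, IsWeaklyDivFree (w τ) := fun τ hτ =>
    hdiv (τ - δ) (by have := hτ.2; linarith)
  have hwmild : ∀ s' t' : ℝ, t < s' → s' < t' → t' < 0 → ∀ y,
      w t' y = UnboundedOperators.heatExtension (w s') (t' - s') y - oseenDuhamel 1 s' w w t' y := by
    intro s' t' _ hst' ht'0 y
    have h := hmild (s' - δ) (t' - δ) (by linarith) (by linarith) y
    rw [show t' - δ - (s' - δ) = t' - s' by ring] at h
    rw [hw, oseenDuhamel_comp_sub_right 1 s' t' δ v v y]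
    exact h
  have hwbd : ∀ τ ∈ Ioo t 0, ∀ y, ‖w τ y‖ ≤ C / Real.sqrt δ := by
    intro τ hτ y
    have hτδ : τ - δ < 0 := by have := hτ.2; linarith
    have h1 := hC (τ - δ) hτδ y
    have hsq : Real.sqrt δ ≤ Real.sqrt (-(τ - δ)) := Real.sqrt_le_sqrt (by have := hτ.2; linarith)
    exact h1.trans (div_le_div_of_nonneg_left hC0 (Real.sqrt_pos.2 hδ0) hsq)
  have hwsm : ContDiffOn ℝ (⊤ : ℕ∞) (uncurry w) (Ioo t 0 ×ˢ univ) :=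
    contDiffOn_of_bounded_oseenMild hwc hwdiv hwmild hwbd
  -- transport back: near `(t, x)`, `v τ' = w (τ' + δ)` with `τ' + δ ∈ (t, 0)`
  refine ⟨Ioo (t - δ / 2) (t + δ / 2) ×ˢ univ, isOpen_Ioo.prod isOpen_univ,
    ⟨⟨by linarith, by linarith⟩, mem_univ _⟩, ?_⟩
  have hmap : ContDiff ℝ ((⊤ : ℕ∞) : WithTop ℕ∞) fun z : ℝ × EuclideanSpace ℝ (Fin 3) => (z.1 + δ, z.2) :=
    (contDiff_fst.add contDiff_const).prodMk contDiff_snd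
  have hinto : MapsTo (fun z : ℝ × EuclideanSpace ℝ (Fin 3) => (z.1 + δ, z.2))
      ((Iio (0 : ℝ) ×ˢ univ) ∩ Ioo (t - δ / 2) (t + δ / 2) ×ˢ univ) (Ioo t 0 ×ˢ univ) := by
    rintro ⟨τ, y⟩ ⟨-, hτ, -⟩
    refine ⟨⟨by have := hτ.1; linarith, ?_⟩, mem_univ _⟩
    have := hτ.2
    rw [hδ] at this ⊢
    linarith
  refine (hwsm.comp hmap.contDiffOn hinto).congr ?_
  rintro ⟨τ, y⟩ -
  simp only [comp_apply, uncurry_apply_pair, hw, add_sub_cancel_right]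

end Smooth

/-! ### Smooth bounded weak solutions on a window are classical -/

section Window

/-- **A jointly smooth bounded weak solution on a window is classical** there, for some pressure:
divergence-freeness at every time from the a.e. weak statement (`isDivFree_of_ae_isWeaklyDivFree_of_smooth`),
the momentum equation tested against divergence-free fields (`integral_inner_momentum_eq_zero_of_slab_weak`),
and de Rham / pressure reconstruction (`exists_isClassicalNSSolutionOn_of_forall_integral_inner_eq_zero`);
Literature form of the window step of `ZoomReturnDoorClassicalLimit.exists_pressure_window`
(KNSS 2009, §4 (ii)–(iii): bounded weak solutions which are regular carry the pressure (4.3)–(4.5)).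
[cite: KochNadirashviliSereginSverak2009, §4 (ii)–(iii) with (4.3)–(4.5) (arXiv:0709.3599v1 p. 8)] -/
theorem exists_isClassicalNSSolutionOn_of_smooth_boundedWeak {V : ℝ → EuclideanSpace ℝ (Fin 3) → EuclideanSpace ℝ (Fin 3)} {a c : ℝ}
    (hsm : IsSmoothSpaceTimeOn (Ioo a c) V)
    (hbw : IsBoundedWeakNSSolutionOn (Ioo a c) isOpen_Ioo 1 V) :
    ∃ q : ℝ → EuclideanSpace ℝ (Fin 3) → ℝ, IsClassicalNSSolutionOn (Ioo a c) 1 0 V q := by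
  -- the shifted window `W σ = V (σ + a)` on `(0, c − a)`
  set T : ℝ := c - a with hT
  set W : ℝ → EuclideanSpace ℝ (Fin 3) → EuclideanSpace ℝ (Fin 3) := fun σ => V (σ + a) with hW
  have hpre : (fun t : ℝ => t + a) ⁻¹' Ioo a c = Ioo 0 T := by
    ext τ
    simp only [mem_preimage, mem_Ioo, hT]
    constructor <;> intro h <;> constructor <;> linarith [h.1, h.2]
  have hWsm : IsSmoothSpaceTimeOn (Ioo 0 T) W := by
    have h1 := hsm.comp_add_right a
    rwa [hpre] at h1
  have hWweak : IsBoundedWeakNSSolutionOn (Ioo 0 T) isOpen_Ioo 1 W :=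
    hbw.comp_add_right a (J := Ioo 0 T) isOpen_Ioo fun τ => by
      simp only [mem_Ioo, hT]
      constructor <;> intro h <;> constructor <;> linarith [h.1, h.2]
  have hWdiv : ∀ τ ∈ Ioo (0 : ℝ) T, VectorCalculus.IsDivFree (W τ) := fun τ hτ =>
    isDivFree_of_ae_isWeaklyDivFree_of_smooth hWsm hWweak.ae_isWeaklyDivFree hτ
  have horth := fun {τ : ℝ} (hτ : τ ∈ Ioo (0 : ℝ) T) {φ : EuclideanSpace ℝ (Fin 3) → EuclideanSpace ℝ (Fin 3)}
      (hφ : FunctionSpaces.IsTestFunctionOn (⊤ : TopologicalSpace.Opens (EuclideanSpace ℝ (Fin 3))) φ)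
      (hφd : VectorCalculus.IsDivFree φ) =>
    integral_inner_momentum_eq_zero_of_slab_weak hWsm hWdiv hWweak.2.2.2 hτ hφ hφd
  have hf0 : IsSmoothSpaceTimeOn (Ioo 0 T) (0 : ℝ → EuclideanSpace ℝ (Fin 3) → EuclideanSpace ℝ (Fin 3)) := contDiffOn_const
  obtain ⟨P, hcl⟩ := exists_isClassicalNSSolutionOn_of_forall_integral_inner_eq_zero isOpen_Ioo
    hWsm hf0 hWdiv (fun τ hτ φ hφ hφd => horth hτ hφ hφd)
  -- translate back to `(a, c)`
  refine ⟨fun t => P (t + -a), ?_⟩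
  have h1 := hcl.comp_add_right (-a)
  have hS : (fun t : ℝ => t + -a) ⁻¹' Ioo 0 T = Ioo a c := by
    ext τ
    simp only [mem_preimage, mem_Ioo, hT]
    constructor <;> intro h <;> constructor <;> linarith [h.1, h.2]
  rw [hS] at h1
  refine h1.congr_velocity fun t _ => ?_
  simp only [hW, neg_add_cancel_right]

end Window

/-! ### The main packaging theorem -/

section Main

variable {u : ℝ → EuclideanSpace ℝ (Fin 3) → EuclideanSpace ℝ (Fin 3)} {p : ℝ → EuclideanSpace ℝ (Fin 3) → ℝ} {G : ℝ → EuclideanSpace ℝ (Fin 3) → EuclideanSpace ℝ (Fin 3) →L[ℝ] EuclideanSpace ℝ (Fin 3)} {C : ℝ}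

/-- **Type-I-rate suitable weak solutions with `𝐈 < ∞` are classical on the open backward slab.**
For `(u, p)` suitable weak (`ν = 1`, no force) on `(−∞, 0) × EuclideanSpace ℝ (Fin 3)` with `‖u(t, x)‖ ≤ C/√(−t)` and
`𝐈(EuclideanSpace ℝ (Fin 3) × ℝ₋) < ∞`, there is `v` with `u = v` a.e. on the slab, `v` continuous on the open slab,
weakly divergence-free slices, the Oseen integral equation for all `s < t < 0`, the rate
`‖v(t,x)‖ ≤ C/√(−t)` everywhere, `v` jointly `C^∞` on `(−∞,0) × EuclideanSpace ℝ (Fin 3)`, and on EVERY window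
`(a, c)` with `c < 0` a pressure `q` with `(v, q)` a classical solution of the Navier–Stokes
equations on `(a, c) × EuclideanSpace ℝ (Fin 3)` (KNSS 2009 §4 (i)–(iii), Prop. 4.1; Albritton–Barker 2019 Thm. 1.1).
[cite: KochNadirashviliSereginSverak2009, §4 (i)–(iii) and Prop. 4.1 (arXiv:0709.3599v1 p. 8); AlbrittonBarker2019, Thm 1.1 (forward direction, §3)] -/
theorem exists_classical_repr_of_typeIBound_lt_top
    (hsw : IsSuitableWeakSolutionOn (slab (EuclideanSpace ℝ (Fin 3)) (Iio 0) isOpen_Iio) 1 0 u p)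
    (hC : HasTypeITimeDecay C u)
    (hI : typeIBound (Iio (0 : ℝ) ×ˢ (univ : Set (EuclideanSpace ℝ (Fin 3)))) u p G < ∞) :
    ∃ v : ℝ → EuclideanSpace ℝ (Fin 3) → EuclideanSpace ℝ (Fin 3),
      (∀ᵐ w ∂(volume.restrict (Iio (0 : ℝ) ×ˢ (univ : Set (EuclideanSpace ℝ (Fin 3))))), uncurry u w = uncurry v w) ∧
      ContinuousOn (uncurry v) (Iio 0 ×ˢ univ) ∧
      (∀ t < 0, IsWeaklyDivFree (v t)) ∧
      (∀ s t : ℝ, s < t → t < 0 → ∀ x,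
        v t x = UnboundedOperators.heatExtension (v s) (t - s) x - oseenDuhamel 1 s v v t x) ∧
      HasTypeITimeDecay C v ∧
      IsSmoothSpaceTimeOn (Iio 0) v ∧
      (∀ a c : ℝ, a < c → c < 0 →
        ∃ q : ℝ → EuclideanSpace ℝ (Fin 3) → ℝ, IsClassicalNSSolutionOn (Ioo a c) 1 0 v q) := by
  obtain ⟨v, hae, hcont, hdiv, hmild, hCv⟩ := exists_oseenMild_repr_of_typeIBound_lt_top hsw hC hI
  have hC0 : 0 ≤ C := by
    have h := hC (-1) (by norm_num) 0
    rw [neg_neg, Real.sqrt_one, div_one] at h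
    exact (norm_nonneg _).trans h
  have hsm : IsSmoothSpaceTimeOn (Iio 0) v := isSmoothSpaceTimeOn_of_oseenAncient_rate hcont hdiv hmild hCv
  refine ⟨v, hae, hcont, hdiv, hmild, hCv, hsm, fun a c hac hc0 => ?_⟩
  -- slice-wise a.e. equality on the window
  have hslice : ∀ᵐ t ∂((volume : Measure ℝ).restrict (Ioo a c)), v t =ᵐ[volume] u t := by
    have h1 : ∀ᵐ w ∂(((volume : Measure ℝ).restrict (Iio 0)).prod (volume : Measure (EuclideanSpace ℝ (Fin 3)))),
        uncurry u w = uncurry v w := by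
      rw [Measure.restrict_prod_eq_prod_univ, ← Measure.volume_eq_prod]
      exact hae
    have h2 := Measure.ae_ae_of_ae_prod h1
    have h3 : ∀ᵐ t ∂((volume : Measure ℝ).restrict (Ioo a c)), ∀ᵐ x ∂(volume : Measure (EuclideanSpace ℝ (Fin 3))),
        uncurry u (t, x) = uncurry v (t, x) :=
      ae_restrict_of_ae_restrict_of_subset (fun t ht => ht.2.trans hc0) h2
    filter_upwards [h3] with t ht
    filter_upwards [ht] with x hx
    exact hx.symm
  -- `u` is a bounded weak solution on the window (suitable weak + the rate), hence so is `v`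
  have hbound : ∀ t ∈ Ioo a c, ∀ x, ‖u t x‖ ≤ C / Real.sqrt (-c) := by
    intro t ht x
    have h1 := hC t (ht.2.trans hc0) x
    have hsq : Real.sqrt (-c) ≤ Real.sqrt (-t) := Real.sqrt_le_sqrt (by linarith [ht.2])
    exact h1.trans (div_le_div_of_nonneg_left hC0 (Real.sqrt_pos.2 (by linarith)) hsq)
  have hswW : IsSuitableWeakSolutionOn (slab (EuclideanSpace ℝ (Fin 3)) (Ioo a c) isOpen_Ioo) 1 0 u p :=
    hsw.of_le (slab_mono fun t ht => ht.2.trans hc0)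
  have hbu : IsBoundedWeakNSSolutionOn (Ioo a c) isOpen_Ioo 1 u := by
    have h1 := hswW.isBoundedWeakNSSolutionOn_timeShift_of_bound hbound
    have h2 := h1.comp_add_right (-a) (J := Ioo a c) isOpen_Ioo fun τ => by
      simp only [mem_Ioo]
      constructor <;> intro h <;> constructor <;> linarith [h.1, h.2]
    have e : (fun t => (fun s y => u (a + s) y) (t + -a)) = u := by
      funext t y
      simp only [add_comm a, neg_add_cancel_right]
    rwa [e] at h2
  have hvm : AEStronglyMeasurable (uncurry v) (volume.restrict (Ioo a c ×ˢ (univ : Set (EuclideanSpace ℝ (Fin 3))))) :=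
    (hcont.mono (prod_mono (fun t ht => ht.2.trans hc0) le_rfl)).aestronglyMeasurable
      (measurableSet_Ioo.prod MeasurableSet.univ)
  have hvb : IsBoundedOn (Ioo a c) v := by
    refine ⟨C / Real.sqrt (-c), fun t ht x => ?_⟩
    have h1 := hCv t (ht.2.trans hc0) x
    have hsq : Real.sqrt (-c) ≤ Real.sqrt (-t) := Real.sqrt_le_sqrt (by linarith [ht.2])
    exact h1.trans (div_le_div_of_nonneg_left hC0 (Real.sqrt_pos.2 (by linarith)) hsq)
  have hbv : IsBoundedWeakNSSolutionOn (Ioo a c) isOpen_Ioo 1 v := hbu.congr_ae hvm hvb hslice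
  exact exists_isClassicalNSSolutionOn_of_smooth_boundedWeak
    (hsm.mono fun t ht => ht.2.trans hc0) hbv

/-- **Closed-strip form** (the frame of the tree's `TaoMainEstimate*` theorems): under the same
hypotheses, for every `b < 0` and `T > 0` the smooth representative `v` is a classical solution on
`[b − T, b] × EuclideanSpace ℝ (Fin 3)` for some pressure. [cite: KochNadirashviliSereginSverak2009, §4 (i)–(iii) and Prop. 4.1 (arXiv:0709.3599v1 p. 8); AlbrittonBarker2019, Thm 1.1 (forward direction, §3)] -/
theorem exists_classical_repr_Icc_of_typeIBound_lt_top
    (hsw : IsSuitableWeakSolutionOn (slab (EuclideanSpace ℝ (Fin 3)) (Iio 0) isOpen_Iio) 1 0 u p)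
    (hC : HasTypeITimeDecay C u)
    (hI : typeIBound (Iio (0 : ℝ) ×ˢ (univ : Set (EuclideanSpace ℝ (Fin 3)))) u p G < ∞) :
    ∃ v : ℝ → EuclideanSpace ℝ (Fin 3) → EuclideanSpace ℝ (Fin 3),
      (∀ᵐ w ∂(volume.restrict (Iio (0 : ℝ) ×ˢ (univ : Set (EuclideanSpace ℝ (Fin 3))))), uncurry u w = uncurry v w) ∧
      ContinuousOn (uncurry v) (Iio 0 ×ˢ univ) ∧
      HasTypeITimeDecay C v ∧
      IsSmoothSpaceTimeOn (Iio 0) v ∧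
      (∀ b T : ℝ, b < 0 → 0 < T →
        ∃ q : ℝ → EuclideanSpace ℝ (Fin 3) → ℝ, IsClassicalNSSolutionOn (Icc (b - T) b) 1 0 v q) := by
  obtain ⟨v, hae, hcont, -, -, hCv, hsm, hwin⟩ := exists_classical_repr_of_typeIBound_lt_top hsw hC hI
  refine ⟨v, hae, hcont, hCv, hsm, fun b T hb hT => ?_⟩
  obtain ⟨q, hq⟩ := hwin (b - T - 1) (b / 2) (by linarith) (by linarith)
  exact ⟨q, hq.mono (fun t ht => ⟨by linarith [ht.1], by linarith [ht.2]⟩)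
    (uniqueDiffOn_Icc (by linarith))⟩

end Main

/-! ### The apex-package form (suitable in every cylinder at the apex, a.e. rate, `𝐈 ≤ M` on cylinders) -/

section ApexPackage

variable {U : ℝ → EuclideanSpace ℝ (Fin 3) → EuclideanSpace ℝ (Fin 3)}
  {P : ℝ → EuclideanSpace ℝ (Fin 3) → ℝ}
  {G : ℝ → EuclideanSpace ℝ (Fin 3) → EuclideanSpace ℝ (Fin 3) →L[ℝ] EuclideanSpace ℝ (Fin 3)}
  {M : ℝ≥0} {C : ℝ}

/-- A pair which is a suitable weak solution in every parabolic cylinder `Q((0,0), a)`, `a > 0`,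
is a suitable weak solution on the whole open backward slab `(−∞, 0) × ℝ³` (the cylinders
`Q((0,0), n+1)` exhaust the slab; CKN's definition is local — `IsSuitableWeakSolutionOn.of_exhaustion`).
[cite: CaffarelliKohnNirenberg1982, §2 (2.1)–(2.5)] -/
theorem isSuitableWeakSolutionOn_slab_of_forall_inBall
    (hsw : ∀ a : ℝ, 0 < a →
      IsSuitableWeakSolutionInBall a (0 : ℝ × EuclideanSpace ℝ (Fin 3)) U P) :
    IsSuitableWeakSolutionOn (slab (EuclideanSpace ℝ (Fin 3)) (Iio 0) isOpen_Iio) 1 0 U P := by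
  refine IsSuitableWeakSolutionOn.of_exhaustion
    (Qn := fun n : ℕ => parabolicCylinderOpens ((n : ℝ) + 1) (0 : ℝ × EuclideanSpace ℝ (Fin 3)))
    (fun n => ?_) (fun n m hnm => ?_) (fun K hK hKc => ?_) (fun n => (hsw _ (by positivity)).1)
  · -- `Q((0,0), n+1) ≤ slab`
    intro z hz
    have hz' := (mem_parabolicCylinder.1 hz).1.2
    exact mem_slab.2 (by simpa using hz')
  · -- monotone
    intro z hz
    obtain ⟨⟨h1, h2⟩, h3⟩ := mem_parabolicCylinder.1 hz
    have hnm' : (n : ℝ) + 1 ≤ (m : ℝ) + 1 := by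
      have : (n : ℝ) ≤ m := by exact_mod_cast hnm
      linarith
    refine mem_parabolicCylinder.2 ⟨⟨lt_of_le_of_lt ?_ h1, h2⟩, h3.trans_le hnm'⟩
    have h0 : (0 : ℝ) ≤ (n : ℝ) + 1 := by positivity
    nlinarith
  · -- every compact subset of the slab lies in some `Q((0,0), n+1)`
    obtain ⟨R, hR⟩ := hKc.isBounded.exists_norm_le
    refine ⟨⌈max R 0⌉₊, fun z hz => ?_⟩
    have hzR : ‖z‖ ≤ R := hR z hz
    have hz1 : z.1 < 0 := by
      have := hK hz
      rw [SetLike.mem_coe, mem_slab] at this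
      exact this
    have hn : R < (⌈max R 0⌉₊ : ℝ) + 1 :=
      lt_of_le_of_lt ((le_max_left R 0).trans (Nat.le_ceil _)) (lt_add_one _)
    have hR0 : 0 ≤ (⌈max R 0⌉₊ : ℝ) := by positivity
    have h1 : |z.1| ≤ R := (norm_fst_le z).trans hzR
    have h2 : ‖z.2‖ ≤ R := (norm_snd_le z).trans hzR
    refine mem_parabolicCylinder.2 ⟨⟨?_, by simpa using hz1⟩, ?_⟩
    · have ha : (⌈max R 0⌉₊ : ℝ) + 1 ≤ ((⌈max R 0⌉₊ : ℝ) + 1) ^ 2 := by nlinarith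
      have := neg_abs_le z.1
      simp only [Prod.fst_zero, zero_sub]
      linarith
    · simpa [dist_zero_right] using lt_of_le_of_lt h2 hn

/-- A parabolic cylinder contained in the backward slab `(−∞, 0) × ℝ³` has its vertex time
`≤ 0` and lies in a cylinder `Q((0,0), a)` at the apex. [folklore] -/
private theorem exists_subset_apexCylinder_of_subset_slab {r : ℝ} (hr : 0 < r)
    {z : ℝ × EuclideanSpace ℝ (Fin 3)}
    (hz : parabolicCylinder r z ⊆ Iio (0 : ℝ) ×ˢ (univ : Set (EuclideanSpace ℝ (Fin 3)))) :
    ∃ a : ℝ, 0 < a ∧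
      parabolicCylinder r z ⊆ parabolicCylinder a (0 : ℝ × EuclideanSpace ℝ (Fin 3)) := by
  -- the vertex time is `≤ 0`
  have hz0 : z.1 ≤ 0 := by
    by_contra h
    push Not at h
    set t : ℝ := z.1 - min (r ^ 2) z.1 / 2 with ht
    have hmin : 0 < min (r ^ 2) z.1 := lt_min (by positivity) h
    have hmem : (t, z.2) ∈ parabolicCylinder r z := by
      refine mem_parabolicCylinder.2 ⟨⟨?_, ?_⟩, by simpa using hr⟩
      · show z.1 - r ^ 2 < t
        have := min_le_left (r ^ 2) z.1
        rw [ht]; linarith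
      · show t < z.1
        rw [ht]; linarith
    have := (mem_prod.1 (hz hmem)).1
    rw [mem_Iio] at this
    have h2 := min_le_right (r ^ 2) z.1
    have : z.1 / 2 ≤ t := by rw [ht]; linarith
    linarith
  refine ⟨‖z.2‖ + r + (r ^ 2 - z.1) + 1,
    by nlinarith [norm_nonneg z.2, sq_nonneg r, hz0, hr], fun w hw => ?_⟩
  obtain ⟨⟨h1, h2⟩, h3⟩ := mem_parabolicCylinder.1 hw
  set a : ℝ := ‖z.2‖ + r + (r ^ 2 - z.1) + 1 with ha
  have ha1 : 1 ≤ a := by rw [ha]; nlinarith [norm_nonneg z.2]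
  have haa : a ≤ a ^ 2 := by nlinarith
  refine mem_parabolicCylinder.2 ⟨⟨?_, ?_⟩, ?_⟩
  · simp only [Prod.fst_zero, zero_sub]
    have : -a ^ 2 ≤ -a := by linarith
    have : -a < z.1 - r ^ 2 := by rw [ha]; nlinarith [norm_nonneg z.2]
    linarith
  · simp only [Prod.fst_zero]
    linarith
  · simp only [Prod.snd_zero, dist_zero_right]
    have : ‖w.2‖ ≤ ‖z.2‖ + dist w.2 z.2 := by
      have := norm_le_norm_add_norm_sub' w.2 z.2
      rwa [← dist_eq_norm] at this
    rw [ha]; nlinarith [norm_nonneg z.2, sq_nonneg r]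

/-- **Classical representative of an apex package** (the frame of the extinct-apex statements of
stmt-NavierStokesRegularity-18385: `(U, P)` suitable weak in every cylinder `Q((0,0), a)`, the
Type-I rate `‖U(s, y)‖ ≤ C/√(−s)` for a.e. `y` at every `s < 0`, and `𝐈(Q((0,0), a)) ≤ M` for all
`a > 0`, any weak-gradient candidate `G`). Then `U` is a.e. equal on `(−∞, 0) × ℝ³` to a field `v`
which is continuous on the open slab, obeys the rate everywhere, is jointly `C^∞`, has weakly
divergence-free slices, solves the Oseen integral equation, and is a CLASSICAL solution of the
Navier–Stokes equations on every window `(a, c) × ℝ³`, `c < 0`, and on every closed strip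
`[b − T, b] × ℝ³`, `b < 0`, for some pressure (KNSS 2009 §4 / Albritton–Barker 2019 Thm. 1.1 via
`exists_classical_repr_of_typeIBound_lt_top`; the a.e. rate is made pointwise by a null
modification, the cylinders exhaust the slab, and `𝐈((−∞,0) × ℝ³) ≤ M` since every admissible
cylinder of the slab lies in some `Q((0,0), a)`).
[cite: KochNadirashviliSereginSverak2009, §4 (i)–(iii) and Prop. 4.1 (arXiv:0709.3599v1 p. 8); AlbrittonBarker2019, Thm 1.1 (forward direction, §3)] -/
theorem exists_classical_repr_of_apexPackage
    (hsw : ∀ a : ℝ, 0 < a →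
      IsSuitableWeakSolutionInBall a (0 : ℝ × EuclideanSpace ℝ (Fin 3)) U P)
    (hI : ∀ a : ℝ, 0 < a →
      typeIBound (parabolicCylinder a (0 : ℝ × EuclideanSpace ℝ (Fin 3))) U P G ≤ (M : ℝ≥0∞))
    (hrate : ∀ s : ℝ, s < 0 →
      ∀ᵐ y : EuclideanSpace ℝ (Fin 3), ‖U s y‖ ≤ C / Real.sqrt (-s)) :
    ∃ v : ℝ → EuclideanSpace ℝ (Fin 3) → EuclideanSpace ℝ (Fin 3),
      (∀ᵐ w ∂(volume.restrict (Iio (0 : ℝ) ×ˢ (univ : Set (EuclideanSpace ℝ (Fin 3))))),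
        uncurry U w = uncurry v w) ∧
      ContinuousOn (uncurry v) (Iio 0 ×ˢ univ) ∧
      HasTypeITimeDecay C v ∧
      IsSmoothSpaceTimeOn (Iio 0) v ∧
      (∀ t < 0, IsWeaklyDivFree (v t)) ∧
      (∀ s t : ℝ, s < t → t < 0 → ∀ x,
        v t x = UnboundedOperators.heatExtension (v s) (t - s) x - oseenDuhamel 1 s v v t x) ∧
      (∀ a c : ℝ, a < c → c < 0 →
        ∃ q : ℝ → EuclideanSpace ℝ (Fin 3) → ℝ, IsClassicalNSSolutionOn (Ioo a c) 1 0 v q) ∧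
      (∀ b T : ℝ, b < 0 → 0 < T →
        ∃ q : ℝ → EuclideanSpace ℝ (Fin 3) → ℝ, IsClassicalNSSolutionOn (Icc (b - T) b) 1 0 v q) := by
  -- ## the slab solution and a strongly measurable representative
  have hslab := isSuitableWeakSolutionOn_slab_of_forall_inBall hsw
  set S : Set (ℝ × EuclideanSpace ℝ (Fin 3)) := Iio (0 : ℝ) ×ˢ (univ : Set (EuclideanSpace ℝ (Fin 3)))
    with hSdef
  have hSm : MeasurableSet S := measurableSet_Iio.prod MeasurableSet.univ
  have hcoe : ((slab (EuclideanSpace ℝ (Fin 3)) (Iio 0) isOpen_Iio :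
      TopologicalSpace.Opens (ℝ × EuclideanSpace ℝ (Fin 3))) : Set (ℝ × EuclideanSpace ℝ (Fin 3))) = S :=
    coe_slab _ _
  have hmeas : AEStronglyMeasurable (uncurry U) (volume.restrict S) := by
    have h := hslab.distributional.1.aestronglyMeasurable
    rwa [hcoe] at h
  set g : ℝ × EuclideanSpace ℝ (Fin 3) → EuclideanSpace ℝ (Fin 3) := hmeas.mk (uncurry U) with hgdef
  have hg : StronglyMeasurable g := hmeas.stronglyMeasurable_mk
  have hfg : ∀ᵐ z ∂(volume.restrict S), uncurry U z = g z := hmeas.ae_eq_mk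
  -- ## `C ≥ 0`
  have hC0 : 0 ≤ C := by
    obtain ⟨y, hy⟩ := (hrate (-1) (by norm_num)).exists
    rw [neg_neg, Real.sqrt_one, div_one] at hy
    exact (norm_nonneg _).trans hy
  -- ## the modified field with the pointwise rate
  set U' : ℝ → EuclideanSpace ℝ (Fin 3) → EuclideanSpace ℝ (Fin 3) := fun s y =>
    if ‖g (s, y)‖ ≤ C / Real.sqrt (-s) then g (s, y) else 0 with hU'def
  have hrate' : HasTypeITimeDecay C U' := by
    intro s hs y
    simp only [hU'def]
    split_ifs with h
    · exact h
    · rw [norm_zero]; positivity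
  -- ## `U = U'` a.e. on the slab
  -- the bad set `B = {z ∈ S | ‖g z‖ > C/√(−z.1)}` is measurable with null slices
  set B : Set (ℝ × EuclideanSpace ℝ (Fin 3)) :=
    {z | z ∈ S ∧ ¬ ‖g z‖ ≤ C / Real.sqrt (-z.1)} with hBdef
  have hBm : MeasurableSet B := by
    have h1 : Measurable fun z : ℝ × EuclideanSpace ℝ (Fin 3) => ‖g z‖ := hg.measurable.norm
    have h2 : Measurable fun z : ℝ × EuclideanSpace ℝ (Fin 3) => C / Real.sqrt (-z.1) :=
      measurable_const.div (Real.continuous_sqrt.measurable.comp measurable_fst.neg)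
    exact hSm.inter (measurableSet_le h1 h2).compl
  have hslice : ∀ᵐ s ∂((volume : Measure ℝ).restrict (Iio 0)),
      ∀ᵐ y ∂(volume : Measure (EuclideanSpace ℝ (Fin 3))), uncurry U (s, y) = g (s, y) := by
    have h1 : ∀ᵐ z ∂(((volume : Measure ℝ).restrict (Iio 0)).prod
        (volume : Measure (EuclideanSpace ℝ (Fin 3)))), uncurry U z = g z := by
      rw [Measure.restrict_prod_eq_prod_univ, ← Measure.volume_eq_prod]
      exact hfg
    exact Measure.ae_ae_of_ae_prod h1
  have hBnull : volume.restrict S B = 0 := by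
    rw [hSdef, Measure.volume_eq_prod, ← Measure.restrict_prod_eq_prod_univ,
      Measure.measure_prod_null hBm]
    filter_upwards [ae_restrict_mem measurableSet_Iio, hslice] with s hs hgs
    have hs0 : s < 0 := hs
    show volume (Prod.mk s ⁻¹' B) = 0
    rw [measure_eq_zero_iff_ae_notMem]
    filter_upwards [hrate s hs0, hgs] with y hy hgy
    simp only [hBdef, mem_preimage, mem_setOf_eq, not_and, not_not]
    intro _
    rw [← hgy]
    exact hy
  have hUU' : ∀ᵐ w ∂(volume.restrict S), uncurry U w = uncurry U' w := by
    have hB' : ∀ᵐ w ∂(volume.restrict S), w ∉ B := measure_eq_zero_iff_ae_notMem.1 hBnull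
    filter_upwards [hfg, hB', ae_restrict_mem hSm] with w hw hwB hwS
    have hle : ‖g w‖ ≤ C / Real.sqrt (-w.1) := by
      by_contra h
      exact hwB ⟨hwS, h⟩
    simp only [uncurry, hU'def, if_pos hle]
    exact hw
  -- ## the three hypotheses of `exists_classical_repr_of_typeIBound_lt_top` for `U'`
  have hslab' : IsSuitableWeakSolutionOn (slab (EuclideanSpace ℝ (Fin 3)) (Iio 0) isOpen_Iio) 1 0 U' P := by
    refine hslab.congr_ae ?_ (Eventually.of_forall fun _ => rfl)
    rw [hcoe]; exact hUU'
  have hIslab : typeIBound S U P G ≤ (M : ℝ≥0∞) := by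
    refine typeIBound_le_iff.2 fun r hr z hz => ?_
    obtain ⟨a, ha, hza⟩ := exists_subset_apexCylinder_of_subset_slab hr hz
    exact (abScaledSum_le_typeIBound hr hza).trans (hI a ha)
  have hI' : typeIBound S U' P G < ∞ := by
    rw [← typeIBound_congr_ae hUU']
    exact hIslab.trans_lt ENNReal.coe_lt_top
  -- ## conclude
  obtain ⟨v, hae, hcont, hdiv, hmild, hCv, hsm, hwin⟩ :=
    exists_classical_repr_of_typeIBound_lt_top hslab' hrate' hI'
  refine ⟨v, ?_, hcont, hCv, hsm, hdiv, hmild, hwin, fun b T hb hT => ?_⟩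
  · filter_upwards [hUU', hae] with w h1 h2
    rw [h1, h2]
  · obtain ⟨q, hq⟩ := hwin (b - T - 1) (b / 2) (by linarith) (by linarith)
    exact ⟨q, hq.mono (fun t ht => ⟨by linarith [ht.1], by linarith [ht.2]⟩)
      (uniqueDiffOn_Icc (by linarith))⟩

end ApexPackage

end Literature.Analysis.FluidPDE

end
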